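import Literature.Analysis.FluidPDE.CorrectorFourierDataDefs
import HarnessLib

/-!
# Fourier-side objects for the linearised Navier–Stokes equation on `T^d`: definitions

Analysis/FluidPDE definition file, first of the files `LinearisedNSFourier*` proving **existence of
smooth solutions of the linearised Navier–Stokes system along a smooth divergence-free field**
`u` on `[0, T] × T^d`,

  `∂ₜw + (u·∇)w + (w·∇)u + ∇q = νΔw`, `div w = 0`, `w(0) = w₀`, `∫ w(t) = 0`,

for `ν > 0`, `T > 0`, `u` jointly smooth and divergence free on `[0, T] × T^d` and a smooth,
divergence-free, mean-zero datum `w₀` (a linear parabolic system with smooth coefficients on a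
closed manifold; Constantin–Foias 1988, Ch. 14, (14.3); Temam 1997, Ch. VI, (3.7)–(3.11); the
derivative of the Navier–Stokes semiflow). As for the scalar advection–diffusion equation
(`ScalarFourier*`, Krylov 1996 Thm. 9.2.3 in smooth periodic form) and for the Cheskidov–Luo
perturbation system (`CorrectorFourier*`), the solution is constructed on the Fourier side: the
unknown is the family of coefficient fields `c l t k = 𝓕(wₗ(t))(k)` (component `l : d`, time
`t`, frequency `k : ℤ^d`); with the drift coefficients `Uⱼ = ûⱼ` the linearised convective terms
have coefficients `linSym U c l = N(U, cₗ) + N(c, Uₗ)` (`N = ScalarFourier.transportSym`: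
products ↦ lattice convolutions, `∂ⱼ ↦ 2πikⱼ`), the Leray projector is the lattice symbol
`CorrectorFourier.leraySym`, and the mild (Duhamel) form of the projected equation,

  `c(l,t,k) = e^{-νₖτ} a(l,k) - ∫₀^τ e^{-νₖ(τ-s)} (P linSym)(U(s), c(s))(l,k) ds`, `τ = clamp T t`,
  `νₖ = 4π²ν|k|²` (`ScalarFourier.heatRate ν`),

is solved by Picard iteration (`picardMap`, `picardIter`, `picardLim`) — the equation being
LINEAR, the iteration contracts on the whole interval in time-weighted sup norms
(file `LinearisedNSFourierPicard`). This file only names the objects: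

* `linSym`, `linProjSym`, `linPresCoef` — the linearised convective symbol, its Leray
  projection, and the pressure coefficients `q̂ = -(∑ₘ kₘ linSymₘ)/(2πi|k|²)`;
* `picardMap ν T U a`, `picardIter`, `picardLim`, `PicardHyp ν T U a` — the clamped Duhamel map
  with datum `a`, its iterates from `0`, their pointwise limit, the hypotheses on the data;
* `linFamily`, `projFamily`, `bootRHS ν` — candidate families of time derivatives
  (`ScalarFourier.transportFamily`), for the bootstrap of time regularity;
* `datumCoeff w₀`, `solCoeff ν T u w₀`, `presCoeffField`, `velC`, `presC`, `vel`, `pres` — the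
  Fourier data of the datum, the solution coefficients for a real background `u` (drift data
  `CorrectorFourier.driftCoeff T u`), the synthesized complex fields and their real parts.

All estimates and properties are in the sequel files (`LinearisedNSFourierEstimates`,
`…Picard`, `…Iteration`, `…TimeRegularity`, `…Data`, `…Synthesis`, `…Solution`).

## References

* P. Constantin, C. Foias, *Navier–Stokes Equations*, Univ. Chicago Press 1988, Ch. 14, (14.3)
  (the linearised equation along a solution). [`ConstantinFoiasNSE1988`]
* R. Temam, *Infinite-Dimensional Dynamical Systems in Mechanics and Physics*, 2nd ed., Springer
  1997, Ch. VI §3.1, (3.7)–(3.11). [`Temam1997`]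
* P. G. Lemarié-Rieusset, *The Navier–Stokes problem in the 21st century*, CRC 2016, §6.1
  (Leray projector as a Fourier multiplier), §8.5 (mild formulation in weighted sup-norms).
* L. Grafakos, *Classical Fourier Analysis*, 3rd ed. (2014), Prop. 3.2.6 (8), §3.3.1. [`Grafakos2014`]
-/

noncomputable section

open MeasureTheory Real Set Filter Topology UnitAddTorus

namespace Literature.Analysis.FluidPDE

namespace LinearisedNSFourier

open ScalarFourier
open CorrectorFourier (leraySym driftCoeff)
open FourierNS (HasDecay clamp)
open Literature.Analysis.FunctionSpaces.Torus (freqNormSq)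

variable {d : Type*} [Fintype d]

/-! ### The symbols -/

section Symbols

/-- The **linearised convective symbol**: the Fourier coefficients of `(u·∇)wₗ + (w·∇)uₗ` in
terms of the coefficient fields `c` (of `w`) and `U` (of `u`): `N(U, cₗ) + N(c, Uₗ)` with the
transport symbol `N = ScalarFourier.transportSym`. [folklore] -/
def linSym (U : d → (d → ℤ) → ℂ) (c : d → (d → ℤ) → ℂ) (l : d) (k : d → ℤ) : ℂ :=
  transportSym U (c l) k + transportSym c (U l) k

/-- Unfolding `linSym`. [folklore] -/
theorem linSym_apply (U : d → (d → ℤ) → ℂ) (c : d → (d → ℤ) → ℂ) (l : d) (k : d → ℤ) :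
    linSym U c l k = transportSym U (c l) k + transportSym c (U l) k := rfl

/-- The **Leray-projected linearised symbol** `(P(k) G(k))ₗ = ∑ₘ P(k)ₗₘ Gₘ(k)`,
`G = linSym U c`, `P = CorrectorFourier.leraySym`. [folklore] -/
def linProjSym [DecidableEq d] (U : d → (d → ℤ) → ℂ) (c : d → (d → ℤ) → ℂ) (l : d) (k : d → ℤ) : ℂ :=
  ∑ m, leraySym l m k * linSym U c m k

/-- Unfolding `linProjSym`. [folklore] -/
theorem linProjSym_apply [DecidableEq d] (U : d → (d → ℤ) → ℂ) (c : d → (d → ℤ) → ℂ) (l : d)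
    (k : d → ℤ) : linProjSym U c l k = ∑ m, leraySym l m k * linSym U c m k := rfl

/-- The **pressure coefficients** `q̂(k) = -(∑ₘ kₘ Gₘ(k)) / (2πi |k|²)`, `G = linSym U c`
(`q̂(0) = 0` by `x/0 = 0`): the solution of `Δq = -div((u·∇)w + (w·∇)u)`
(Lemarié-Rieusset 2016, §6.1). [folklore] -/
def linPresCoef (U : d → (d → ℤ) → ℂ) (c : d → (d → ℤ) → ℂ) (k : d → ℤ) : ℂ :=
  -(∑ m, (k m : ℂ) * linSym U c m k) / (2 * π * Complex.I * (freqNormSq k : ℂ))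

/-- Unfolding `linPresCoef`. [folklore] -/
theorem linPresCoef_apply (U : d → (d → ℤ) → ℂ) (c : d → (d → ℤ) → ℂ) (k : d → ℤ) :
    linPresCoef U c k =
      -(∑ m, (k m : ℂ) * linSym U c m k) / (2 * π * Complex.I * (freqNormSq k : ℂ)) := rfl

end Symbols

/-! ### The Picard iteration on `[0, T]` -/

section Picard

variable [DecidableEq d]

/-- The **clamped Duhamel (Picard) map** of the mild formulation of the projected linearised
equation with datum `a` and viscosity `ν` on `[0, T]`: with `τ = clamp T t`,
`Φ(c)(l, t, k) = e^{-νₖτ} a(l,k) - ∫₀^τ e^{-νₖ(τ-s)} (P linSym)(U(s), c(s))(l, k) ds`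
(on `[0, T]` the genuine Duhamel formula for `∂ₜcₗ = -νₖ cₗ - (P G)ₗ`). [folklore] -/
def picardMap (ν T : ℝ) (U : d → ℝ → (d → ℤ) → ℂ) (a : d → (d → ℤ) → ℂ)
    (c : d → ℝ → (d → ℤ) → ℂ) (l : d) (t : ℝ) (k : d → ℤ) : ℂ :=
  (heatFactor ν k (clamp T t) : ℂ) * a l k -
    ∫ s in (0 : ℝ)..clamp T t, (heatFactor ν k (clamp T t - s) : ℂ) *
      linProjSym (fun j => U j s) (fun j => c j s) l k

/-- The **Picard iterates** `c₀ = 0`, `cₙ₊₁ = Φ(cₙ)`. [folklore] -/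
def picardIter (ν T : ℝ) (U : d → ℝ → (d → ℤ) → ℂ) (a : d → (d → ℤ) → ℂ) :
    ℕ → d → ℝ → (d → ℤ) → ℂ
  | 0 => fun _ _ _ => 0
  | n + 1 => picardMap ν T U a (picardIter ν T U a n)

/-- `c₀ = 0`. [folklore] -/
@[simp]
theorem picardIter_zero (ν T : ℝ) (U : d → ℝ → (d → ℤ) → ℂ) (a : d → (d → ℤ) → ℂ) :
    picardIter ν T U a 0 = fun _ _ _ => 0 := rfl

/-- `cₙ₊₁ = Φ(cₙ)`. [folklore] -/
theorem picardIter_succ (ν T : ℝ) (U : d → ℝ → (d → ℤ) → ℂ) (a : d → (d → ℤ) → ℂ) (n : ℕ) :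
    picardIter ν T U a (n + 1) = picardMap ν T U a (picardIter ν T U a n) := rfl

/-- The **Picard limit** `c(l, t, k) = limₙ cₙ(l, t, k)` (pointwise `limUnder`; the genuine
limit under `PicardHyp`, file `LinearisedNSFourierIteration`). [folklore] -/
def picardLim (ν T : ℝ) (U : d → ℝ → (d → ℤ) → ℂ) (a : d → (d → ℤ) → ℂ) (l : d) (t : ℝ)
    (k : d → ℤ) : ℂ :=
  limUnder atTop fun n => picardIter ν T U a n l t k

/-- **Hypotheses of the Picard iteration** on the Fourier-side data: `ν > 0`, `T > 0`; the
drift coefficients `Uⱼ(t)` are continuous in `t ∈ ℝ` at every frequency and have every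
polynomial decay uniformly in `t ∈ ℝ` and `j` (in the application: the coefficients of the
smooth background at clamped time); the datum `a l` has every polynomial decay. [folklore] -/
structure PicardHyp (ν T : ℝ) (U : d → ℝ → (d → ℤ) → ℂ) (a : d → (d → ℤ) → ℂ) : Prop where
  /-- positive viscosity -/
  hν : 0 < ν
  /-- positive final time -/
  hT : 0 < T
  /-- the drift coefficients are continuous in time at each frequency -/
  contU : ∀ j m, Continuous fun t => U j t m
  /-- every polynomial decay of the drift coefficients, uniformly in time and component -/
  decayU : ∀ K : ℕ, ∃ A : ℝ, ∀ j t, HasDecay K A (U j t)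
  /-- every polynomial decay of the datum, uniformly in the component -/
  decayA : ∀ K : ℕ, ∃ A₀ : ℝ, ∀ l, HasDecay K A₀ (a l)

end Picard

/-! ### Families of time derivatives -/

section Family

/-- The **linearised convective family**: the candidate for `∂ₜⁱ linSym` along families `UF ⱼ`
(drift) and `CF l` (velocity components) — two transport families
(`ScalarFourier.transportFamily`). [folklore] -/
def linFamily (UF : d → ℕ → ℝ → (d → ℤ) → ℂ) (CF : d → ℕ → ℝ → (d → ℤ) → ℂ) (l : d) :
    ℕ → ℝ → (d → ℤ) → ℂ :=
  fun i t k => transportFamily UF (CF l) i t k + transportFamily CF (UF l) i t k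

/-- `linFamily` at order `0` is `linSym` of the zeroth members. [folklore] -/
@[simp]
theorem linFamily_zero (UF : d → ℕ → ℝ → (d → ℤ) → ℂ) (CF : d → ℕ → ℝ → (d → ℤ) → ℂ) (l : d)
    (t : ℝ) (k : d → ℤ) :
    linFamily UF CF l 0 t k = linSym (fun j => UF j 0 t) (fun j => CF j 0 t) l k := by
  simp [linFamily, linSym]

variable [DecidableEq d]

/-- The **projected family**: `∑ₘ P(k)ₗₘ · linFamily m` (the projector is time independent). [folklore] -/
def projFamily (UF : d → ℕ → ℝ → (d → ℤ) → ℂ) (CF : d → ℕ → ℝ → (d → ℤ) → ℂ) (l : d) :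
    ℕ → ℝ → (d → ℤ) → ℂ :=
  fun i t k => ∑ m, leraySym l m k * linFamily UF CF m i t k

/-- `projFamily` at order `0` is `linProjSym` of the zeroth members. [folklore] -/
@[simp]
theorem projFamily_zero (UF : d → ℕ → ℝ → (d → ℤ) → ℂ) (CF : d → ℕ → ℝ → (d → ℤ) → ℂ) (l : d)
    (t : ℝ) (k : d → ℤ) :
    projFamily UF CF l 0 t k = linProjSym (fun j => UF j 0 t) (fun j => CF j 0 t) l k := by
  simp [projFamily, linProjSym]

/-- The **right-hand side of the differentiated mild system** along a velocity family `CF`: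
`(bootRHS ν UF CF) l i = -νₖ CF l i - projFamily l i`, the candidate for `∂ₜ (CF l i)` when
`CF l 0 = cₗ` solves `∂ₜcₗ = -νₖ cₗ - (P G)ₗ`. [folklore] -/
def bootRHS (ν : ℝ) (UF : d → ℕ → ℝ → (d → ℤ) → ℂ) (CF : d → ℕ → ℝ → (d → ℤ) → ℂ) (l : d) :
    ℕ → ℝ → (d → ℤ) → ℂ :=
  fun i t k => -(heatRate ν k : ℂ) * CF l i t k - projFamily UF CF l i t k

/-- Unfolding `bootRHS`. [folklore] -/
theorem bootRHS_apply (ν : ℝ) (UF : d → ℕ → ℝ → (d → ℤ) → ℂ) (CF : d → ℕ → ℝ → (d → ℤ) → ℂ)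
    (l : d) (i : ℕ) (t : ℝ) (k : d → ℤ) :
    bootRHS ν UF CF l i t k = -(heatRate ν k : ℂ) * CF l i t k - projFamily UF CF l i t k := rfl

end Family

/-! ### The data of a real background and datum; the synthesized solution -/

section Data

/-- The **Fourier coefficients of the datum**, componentwise and complexified:
`datumCoeff w₀ l k = 𝓕((w₀ · l : ℂ))(k)`. [folklore] -/
def datumCoeff (w₀ : UnitAddTorus d → EuclideanSpace ℝ d) (l : d) (k : d → ℤ) : ℂ :=
  mFourierCoeff (fun x => ((w₀ x l : ℝ) : ℂ)) k

/-- Unfolding `datumCoeff`. [folklore] -/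
theorem datumCoeff_apply (w₀ : UnitAddTorus d → EuclideanSpace ℝ d) (l : d) (k : d → ℤ) :
    datumCoeff w₀ l k = mFourierCoeff (fun x => ((w₀ x l : ℝ) : ℂ)) k := rfl

variable [DecidableEq d]

/-- The **coefficient field of the solution** of the linearised equation on `[0, T]` with
background `u` and datum `w₀`: the Picard limit for the drift data
`CorrectorFourier.driftCoeff T u` (coefficients of the complexified components at clamped time)
and the datum data `datumCoeff w₀` (`c(l, t, k) = 𝓕(wₗ(t))(k)` once synthesized). [folklore] -/
def solCoeff (ν T : ℝ) (u : ℝ → UnitAddTorus d → EuclideanSpace ℝ d)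
    (w₀ : UnitAddTorus d → EuclideanSpace ℝ d) : d → ℝ → (d → ℤ) → ℂ :=
  picardLim ν T (driftCoeff T u) (datumCoeff w₀)

/-- The **pressure coefficient field** `q̂(t, k) = linPresCoef(U(t), c(t))(k)`. [folklore] -/
def presCoeffField (ν T : ℝ) (u : ℝ → UnitAddTorus d → EuclideanSpace ℝ d)
    (w₀ : UnitAddTorus d → EuclideanSpace ℝ d) : ℝ → (d → ℤ) → ℂ :=
  fun t k => linPresCoef (fun j => driftCoeff T u j t) (fun j => solCoeff ν T u w₀ j t) k

/-- Unfolding `presCoeffField`. [folklore] -/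
theorem presCoeffField_apply (ν T : ℝ) (u : ℝ → UnitAddTorus d → EuclideanSpace ℝ d)
    (w₀ : UnitAddTorus d → EuclideanSpace ℝ d) (t : ℝ) (k : d → ℤ) :
    presCoeffField ν T u w₀ t k =
      linPresCoef (fun j => driftCoeff T u j t) (fun j => solCoeff ν T u w₀ j t) k := rfl

/-- The **synthesized complex velocity components** `Vₗ(t, x) = ∑ₖ c(l, t, k) e_k(x)`
(`ScalarFourier.torusSynth`; Grafakos 2014, §3.3.1). [folklore] -/
def velC (ν T : ℝ) (u : ℝ → UnitAddTorus d → EuclideanSpace ℝ d)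
    (w₀ : UnitAddTorus d → EuclideanSpace ℝ d) (l : d) : ℝ → UnitAddTorus d → ℂ :=
  torusSynth (solCoeff ν T u w₀ l)

/-- The **synthesized complex pressure** `Q(t, x) = ∑ₖ q̂(t, k) e_k(x)`. [folklore] -/
def presC (ν T : ℝ) (u : ℝ → UnitAddTorus d → EuclideanSpace ℝ d)
    (w₀ : UnitAddTorus d → EuclideanSpace ℝ d) : ℝ → UnitAddTorus d → ℂ :=
  torusSynth (presCoeffField ν T u w₀)

/-- The **velocity of the solution**: the real vector field with components `Re Vₗ`. [folklore] -/
def vel (ν T : ℝ) (u : ℝ → UnitAddTorus d → EuclideanSpace ℝ d)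
    (w₀ : UnitAddTorus d → EuclideanSpace ℝ d) : ℝ → UnitAddTorus d → EuclideanSpace ℝ d :=
  fun t x => WithLp.toLp 2 fun l => (velC ν T u w₀ l t x).re

/-- The components of `vel`. [folklore] -/
@[simp]
theorem vel_apply (ν T : ℝ) (u : ℝ → UnitAddTorus d → EuclideanSpace ℝ d)
    (w₀ : UnitAddTorus d → EuclideanSpace ℝ d) (t : ℝ) (x : UnitAddTorus d) (l : d) :
    vel ν T u w₀ t x l = (velC ν T u w₀ l t x).re := rfl

/-- The **pressure of the solution**: `Re Q`. [folklore] -/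
def pres (ν T : ℝ) (u : ℝ → UnitAddTorus d → EuclideanSpace ℝ d)
    (w₀ : UnitAddTorus d → EuclideanSpace ℝ d) : ℝ → UnitAddTorus d → ℝ :=
  fun t x => (presC ν T u w₀ t x).re

/-- Unfolding `pres`. [folklore] -/
@[simp]
theorem pres_apply (ν T : ℝ) (u : ℝ → UnitAddTorus d → EuclideanSpace ℝ d)
    (w₀ : UnitAddTorus d → EuclideanSpace ℝ d) (t : ℝ) (x : UnitAddTorus d) :
    pres ν T u w₀ t x = (presC ν T u w₀ t x).re := rfl

end Data

end LinearisedNSFourier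

end Literature.Analysis.FluidPDE

end
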